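import Mathlib
import HarnessLib
import HarnessLib.Audit
import Summits.Parity.Statement
import Literature.NumberTheory.Sieve.MaynardTao
import Literature.NumberTheory.Sieve.PolymathBoundedGaps
import Literature.NumberTheory.Sieve.LevelOfDistribution
import Literature.NumberTheory.Sieve.PolymathProductTestFunctions
import HarnessLib.Audit.Status.Attr

/-!
Route: MaynardProductExact

CLOSED (proved) 2026-08-31T14:28:58Z by operator:999:1392461 — reason: proved:Summit.Parity.GeneralizedHardyLittlewood.MaynardProductExactHTwoLe34052.hTwoLe34052_proof — note: success close on decomp-parity-writer-1 g23 CLOSE-VERB ASK (REQUESTS l.67486 (1a)): target stmt-Parity-19282 closed·proved p823392 + support 19252 p823391; route rev 11 finish ALL PROVED; programme route, zero summit credit; operator priority29. The file is kept as the record of this route; refuted decls are indexed as negative knowledge (`ledger negatives`).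

# Route MaynardProductExact — H₂ ≤ 34 052 under Bombieri–Vinogradov from the exactly evaluated
product test function at k = 3750 (two kernel-replayable 1-D convolution-power bounds)

RUNG ROUTE (D-0059/D-0061, class rung "H_m explicit"; closes its own rank-0 target `HTwoLe34052 : ∃ᶠ
n : ℕ in atTop, p_{n+2} ≤ p_n + 34 052`,
never summit credit; printed record H₂ ≤ H(35 265) ≤ 396 516, Stadlmann 2023/25, and 398 130, PM8b
Thm 1.4(ii)). It suffices to show X = NumLB3749 ∧
DenUB3750 ∧ Tuple3750. By the tree identity
`MaynardTao.maynardFunctional_productTestFn_polymathProfile` (PM8b §6, module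
PolymathProductTestFunctions,
PROVED) the Maynard functional of the product test function F_{c,T} = 1_{R_k}∏ g(tᵢ), g =
polymathProfile 3750 (249/2000) (3/4) = 1/(c+3749t)·1_{[0,3/4]},
equals 3750·N/D with N = ∫_{(0,1]} (∫₀^{1−w} g)² (g²)^{⋆3749}(w) dw and D = ∫_{(0,1]}
(g²)^{⋆3750}(w) dw (one-sided convolution powers
`Literature.Analysis.Convolution.cpow`). The cell's certificate CERT-C (kit j247320 case 2; exact
integer convolution powers on the lattice 1/(8·10⁶),
exact rational final inequality, value 8.0233; refereed integer-exactly by two lineages) is WEAKENED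
to the pair a `decide +kernel` lattice certificate
can replay by plain floor coupling at J = 8·10⁶ slots (parity-lit farm probe 02:51Z; p3 float
predictor kit j249077): NumLB3749 : N ≥ 1.9076·10⁻⁶·m₂^{3749}
and DenUB3750 : D ≤ 0.41694·m₂^{3750} (m₂ = ∫g² = 10⁶/466 771 167; 3750·1.9076·10⁻⁶/(0.41694·m₂) =
8.00846 > 8) — the route's two CRUXES, pure
one-variable real analysis + arithmetic. Everything
downstream is PROVED in route4/Sketch.lean (farm rc 0, 0 sorry): `CertGlue : NumLB3749 → DenUB3750 →
MkCert3750` (M_3750 > 8; key step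
8·0.41694·m₂ < 3750·1.9076·10⁻⁶ by `norm_num`), and `Assembly : MkCert3750 → Tuple3750 →
HTwoLe34052` from the tree THEOREMS
`BombieriVinogradovStatement_holds` (at the level ϑ = 1/4 + 2/M ∈ (4/M, 1/2), M = M(F) > 8),
`frequently_card_primes_ge_of_maynardFunctional_holds` (Maynard Prop. 4.2),
`weakDHL_of_maynardFunctional_gt` (PM8b Thm 3.8) and
`WeakDicksonHardyLittlewood.frequently_nth_prime_add_le`; Tuple3750 (diameter 34 052) is the
printed-standard database tuple, kernel-decided in parity-lit's `NarrowAdmissibleTuple3750.lean`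
(farm rc 0; support, closes by name on landing).
Lean: `((19076 : ℝ) / 10000000000 * ((1000000 : ℝ) / 466771167) ^ 3749 ≤ ∫ w in Set.Ioc (0 : ℝ) 1,
(∫ u in (0 : ℝ)..(1 - w), Literature.NumberTheory.Sieve.MaynardTao.polymathProfile 3750 ((249 : ℝ) /
2000) ((3 : ℝ) / 4) u) ^ 2 * Literature.Analysis.Convolution.cpow (fun t =>
Literature.NumberTheory.Sieve.MaynardTao.polymathProfile 3750 ((249 : ℝ) / 2000) ((3 : ℝ) / 4) t ^
2) 3749 w) ∧ (∫ w in Set.Ioc (0 : ℝ) 1, Literature.Analysis.Convolution.cpow (fun t =>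
Literature.NumberTheory.Sieve.MaynardTao.polymathProfile 3750 ((249 : ℝ) / 2000) ((3 : ℝ) / 4) t ^
2) 3750 w ≤ (41694 : ℝ) / 100000 * ((1000000 : ℝ) / 466771167) ^ 3750) ∧ (∃ H : Finset ℤ,
Literature.NumberTheory.Sieve.IsAdmissibleTuple H ∧ H.card = 3750 ∧ ∀ a ∈ H, ∀ b ∈ H, b - a ≤ (34052
: ℤ))`

## Assembly
From MkCert3750 obtain F with M = functional(F) > 8; `BombieriVinogradovStatement_holds` at ϑ = 1/4
+ 2/M (< 1/2 since M > 8) gives `PrimesHaveLevel ϑ`;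

CLOSES_TARGET: closes rung F-P1.R4 of Parity: Summit.Parity.GeneralizedHardyLittlewood.Theses.MaynardProductExact.HTwoLe34052 (D-0061; not the summit Statement) — the deciding theorem of this route concludes that registered leaf instead of the Statement decl `GeneralizedHardyLittlewood` (class rung: servable and labelled, never counted as concluding the summit Statement).

Rationale: WHY THIS LINE. Polymath 8b (arXiv:1407.4897) Thm 3.9 (ix) proves M_41588 > 8 by bounding the product
family from below with Chebyshev on the event
S_{k−1} ≤ 1−T (eqs (6.12)–(6.15)); Stadlmann (arXiv:2309.00425, §2) re-optimises the same inequality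
(k = 35 265 with his level 0.5253);
Granville (arXiv:1410.8400, p. 20) and PM8b §11 name the numerical evaluation of M_k for large k as
the open computational problem. The
cell's ROUND 3 replaced the inequality by the EXACT value of the functional on the family: kJ/I =
(k/m₂)·E[G(min(T,1−S_{k−1}))²; S_{k−1} ≤ 1]
/ P(S_k ≤ 1) with Xᵢ iid of density g²/m₂ — two one-dimensional convolution powers — and found the
optimum in the regime the printed
analyses cannot see (T ≈ 0.65–0.75, P(S_k ≤ 1) ≈ 0.42, the L²-mass straddling ∂R_k), threshold
k* ≈ 3 500 instead of 41 588 (float optimum 8.20 against the cap (k/(k−1))log k = 8.414 at k = 4500,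
certified 8.184;
8.03 against 8.232 at k = 3750, certified 8.023). Imported area: exact distributional computation
(renewal/convolution algebra in FLINT, Arb balls) and the
Gnedenko–Kolmogorov limit law of the family (Landau-type infinitely divisible limit, constant c₀ =
0.333) pointed at the sieve-theoretic
variational problem; the number theory (BV, Maynard's Prop. 4.2) is the tree's, unchanged (both
proved there).

RANKED CRUXES. #0 HTwoLe34052 (target) — H₂ ≤ 34 052: for infinitely many n, p_{n+2} ≤ p_n + 34 052
(the rung; printed record 396 516). Same-file alternative closer to be registered (class rung), as
for list 8. [deps: NumLB3749, DenUB3750, Tuple3750, CertGlue, MkCert3750, Assembly] [difficulty: XL]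
(why it might fail: it follows from NumLB3749, DenUB3750, Tuple3750 by the PROVED CertGlue and
Assembly (route4/Sketch.lean `hTwoLe34052_of`); it fails only if the certificate CERT-C is wrong.)
[Polymath8b2014, arXiv:2309.00425]
#2 NumLB3749 (crux) — the numerator bound, re-cut for kernel replay: N = ∫_{(0,1]} (∫₀^{1−w} g(u)
du)² (g²)^{⋆3749}(w) dw ≥ 1.9076·10⁻⁶ · m₂^{3749}, g = 1/(249/2000 + 3749 t) on [0, 3/4] (0
elsewhere), m₂ = 10⁶/466 771 167 = ∫g²; equivalently E[G(min(T, 1 − S₃₇₄₉))²; S₃₇₄₉ ≤ 1] ≥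
1.9076·10⁻⁶ for Xᵢ iid of density g²/m₂ (worst-case floor-lattice value at J = 8·10⁶: 1.907641·10⁻⁶,
j249077; refereed recentred CERT-C value 1.9095558·10⁻⁶; true ≈ 1.90982·10⁻⁶). [difficulty: XL] (why
it might fail: weaker than the refereed CERT-C value 1.9095558e-6 (reproduced integer-exactly
twice), so only a cell/shift-convention mismatch between the typed integral and the certificate
could break it; kernel replay needs J=8e6 slots (j249077: at J=4e6 the worst-case sum 1.9055e-6 <
constant).) [Polymath8b2014, arXiv:1407.4897, Maynard2015]
#3 DenUB3750 (crux) — the denominator bound, re-cut for kernel replay: D = ∫_{(0,1]} (g²)^{⋆3750}(w)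
dw ≤ 0.41694 · m₂^{3750}; equivalently P(S₃₇₅₀ ≤ 1) ≤ 0.41694 for Xᵢ iid of density g²/m₂ (plain
floor-lattice value at J = 8·10⁶: 0.41692867, j249077; refereed recentred CERT-C value 0.41659735;
true ≈ 0.416551). [difficulty: XL] (why it might fail: weaker than the refereed CERT-C value
0.41659735 (reproduced integer-exactly twice); kernel replay by plain floor coupling needs J=8e6
slots (j249077: J=4e6 gives 0.41731 > constant); a cell-convention mismatch vs the typed integral is
the only mathematical risk.) [Polymath8b2014, arXiv:1407.4897, arXiv:2309.00425]
#9 MkCert3750 (support) — M_3750 > 8 (the DHL[3750,3]-under-BV threshold form): there is a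
Maynard-admissible F on R_3750 with (Σ_m J^{(m)}(F))/I(F) > 8 — witnessed by the product test
function `productTestFn 3750 (polymathProfile 3750 (249/2000) (3/4))` (admissible:
`MaynardTao.isMaynardAdmissible_productTestFn_polymathProfile`, PROVED); certified value ≥
8.0232649249. Derived node: follows from NumLB3749 and DenUB3750 by CertGlue (PROVED); kept as a
named statement because other rungs (EH: H₄ ≤ 34 052) reuse it. [deps: NumLB3749, DenUB3750,
CertGlue] [difficulty: XL] (why it might fail: only with NumLB3749/DenUB3750 (it is their
consequence by a proved lemma).) [Polymath8b2014, Maynard2015]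
#9 CertGlue (support) — the two certificate halves give M_3750 > 8: functional(F_{c,T}) = 3750·N/D
(tree identity), D = I(F) > 0, and 8 · 0.41694 · m₂ < 3750 · 1.9076·10⁻⁶ (exact rationals; ratio
8.00846). PROVED: route4/Sketch.lean `certGlue_holds` (farm rc 0, 0 sorry) — a prover's one-file
landing. [difficulty: S] (why it might fail: it cannot (proved); listed so that the cone is
explicit.) [Polymath8b2014]
#9 Tuple3750 (support) — an admissible 3750-tuple of integers with all differences ≤ 34 052 exists:
the narrowest known 3750-tuple of Sutherland's Polymath8 database (fetched and re-verified
admissible by parity-lit and by the referee with independent sieves; kernel-decided by a bitset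
certificate in parity-lit's `Literature/NumberTheory/Sieve/NarrowAdmissibleTuple3750.lean`, theorem
`exists_isAdmissibleTuple_card_3750`, farm rc 0 — closes BY NAME when that file lands; the cell's
own sieved tuple gives 35 340 as a fall-back). [difficulty: M] (why it might fail: it cannot
mathematically (decidable, verified three times in independent code); Lean cost only (3750 literals,
residue witnesses for the 523 primes ≤ 3750).) [Polymath8b2014, arXiv:1407.4897]

TWO-LAYER PLAN. Each crux has a registered-shape BC3 skeleton with two GENUINE stubs and a proved
composition (route4/bc/DenUB3750_birth.lean,
route4/bc/NumLB3749_birth.lean; farm rc 0, sorries = stubs = 2 each): (i) a COUPLING SANDWICH valid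
on every lattice 1/N — DenUB3750:
D ≤ Σ_{J ≤ N} (p^{⋆3750})_J with floor-cell masses p_j = ∫_{[j/N,(j+1)/N)} g² (`⌊N x⌋/N ≤ x`,
push-forward of (g² dx)^{⊗k} = discrete convolution
power = `PowerSeries.coeff J ((PowerSeries.mk p)^3750)`); NumLB3749: Σ_{J ≤ N} G(1 − J/N)²
(q^{⋆3749})_J ≤ N with ceiling-cell masses q_j =
∫_{((j−1)/N, j/N]} g² (`x ≤ ⌈N x⌉/N`, G = ∫₀^· g monotone) — measure theory + induction on k over
`cpow_succ`, M/L-sized, reusable for every k;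
(ii) a LATTICE CERTIFICATE ∃ N, discrete sum ≤ / ≥ the rational bound — pure exact arithmetic (cell
masses are the rationals
(1/3749)(1/(c+3749 j/N) − 1/(c+3749 (j+1)/N)); G(x) = log((c+3749 min(x,3/4))/c)/3749 needs a
certified rational lower bound for log), XL but
REPLAYABLE: parity-lit's farm probe (02:51Z) times in-kernel GMP arithmetic (`decide +kernel`) at ≈
3 min per 10⁶ Kronecker-packed slots, and the
constants were re-cut (rev 1–3) to the plain floor-coupling values at N = 8·10⁶ predicted by kit
j249077 (worst-case LB 8.0089 > 8; at N = 4·10⁶ it is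
7.9925 < 8, so N ≥ 8·10⁶ is needed — or Hoeffding recentring at N ≈ 10⁶); the sandwich layer is
parity-lit's p418383
`Literature/Analysis/Convolution/ConvolutionPowerDiscretization.lean`
(`setIntegral_cpow_le_sum_dconvPow`, `sum_primitiveSq_mul_dconvPow_le`, PROVED, in review). The
split into (i)+(ii) is where tenure decomposes first (`--split DenUB3750 --into
FloorCoupling LatticeCertDen`), not at open.

KILL CRITERIA. An independent exact re-run of mk_cert.py (or any re-implementation of the two
convolution powers with outward rounding) giving num < 1.9076·10⁻⁶
or den > 0.41694 at (k,c,T) = (3750, 249/2000, 3/4) kills NumLB3749 / DenUB3750 as evidenced (the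
refereed values are 1.90956·10⁻⁶ / 0.416597, far inside) — fall back to CERT-B (k = 4000, LB 8.0865,
H₂ ≤ 36 610
database / 37 932 own tuple) or CERT-A (k = 4500, LB 8.1840, 41 664 / 43 270): a pivot (new cruxes
with those constants), not death of the line; a
disproof of the iid representation is no longer possible (PROVED in Literature, p415369). A
residue-class cover mod some p ≤ 3750 of the database
tuple kills Tuple3750 at 34 052 (fall back to the cell tuple, 35 340). Nothing in number theory can
kill the route: BV, Maynard's Prop. 4.2 and
PM8b Thm 3.8 are theorems of the tree (axiom-clean).

NOT DECOMPOSED YET. The lattice-certificate stubs (format of the kernel replay: exact rational cell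
masses, a big-integer discrete convolution power by repeated
squaring over `Polynomial ℚ`/lists with a verified truncation at degree N, certified log bounds for
G; or an analytic Edgeworth-type two-sided
bound with explicit constants at a larger k where the margin allows it) are left to the prover layer
/ tenure split; the tuple is parity-lit's file.

CHEAPEST FALSIFIER. `JOB_K=2 JOB_C=14/25 JOB_N1=2000000 JOB_J=2000000 python mk_cert.py` must print
LB ∈ [1.38, 1.38593] (PM8b Cor 6.3: M₂ = 1.38593…) — DONE
(kit j246836: 1.3845139); Monte-Carlo of the two expectations at (3750, 249/2000, 3/4) with 10⁶
samples must give num ≈ 1.91·10⁻⁶, den ≈ 0.4166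
— DONE at k = 1000/5511 (j246834, within 3σ) and by the referee's independent float at k = 3750;
next cheapest: an exact-rational re-run of the PLAIN floor coupling at h = 1/(8·10⁶) (kit, minutes)
must give num ≥ 1.9076·10⁻⁶ and den ≤ 0.41694 (float prediction j249077: 1.907641·10⁻⁶ / 0.41692867)
— else the constants are re-cut from that log.

NUMBERS. Threshold 2m/ϑ ↓ 8 (m = 2, ϑ ↑ 1/2); certified LB = 8.0232649249 =
56869195418372364139983150410496694889229/7088036597437711921072310947358231756800
(evidence3/j247320 log case 2: num_lo = 1.9095557645·10⁻⁶, den_hi = 0.41659734894, J = 6·10⁶ lattice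
points on [0,T], h = 1/(8·10⁶), Hoeffding-recentred);
crux constants (rev 1–3, kernel-feasibility re-cut) 1.9076·10⁻⁶ and 0.41694 = the plain
floor-coupling values at h = 1/(8·10⁶) predicted by kit j249077
(1.907641·10⁻⁶ / 0.41692867; worst-case LB 8.0089; at h = 1/(4·10⁶): 7.9925, too coarse); glue
inequality 8·0.41694·m₂ = 7.14594·10⁻³ < 3750·1.9076·10⁻⁶ =
7.1535·10⁻³ (ratio 8.00846, margin 1.06·10⁻³, `norm_num`); other kernel-feasible rungs of the same
lever (j249077): k = 4500 at h = 10⁻⁶ (LB 8.043 → H₂ ≤ 41 664),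
k = 4000 at h = 1/(4·10⁶) (LB 8.053 → 36 610); m₂ = T/(c(c+(k−1)T)) = 10⁶/466 771 167; ceiling
(k/(k−1))log k = 8.2317 (PM8b Cor 6.4,
tree `maynardFunctional_le_holds`); family threshold k* ≈ 3 480 (ρ₂) / 3 650 (ρ₁) vs 41 588 (PM8b
BV) / 35 265 (Stadlmann); H(3750) ≤ 34 052
(database; cell tuple 35 340) vs record H₂ ≤ 396 516; limit constant c₀ = 0.333 ± 0.002 (family
value log k − c₀ + o(1)). Items at open: 7 (target,
2 cruxes, 3 supports, assembly); load-bearing OPEN binders of `closes`: NumLB3749, DenUB3750,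
Tuple3750 (+ the proved CertGlue, Assembly). BC5
witness pair (the lever in miniature, kernel theorems of the tree):
`Literature.NumberTheory.Sieve.exists_two_lt_maynardFunctional_five_holds` with the
EXACT value `MaynardTao.maynardFunctional_maynardF5 : maynardFunctional 5 maynardF5 =
1417255/708216` (> 2) — the functional side decided exactly
in the kernel where the prime side (DHL[5,2], p_{n+1} − p_n ≤ 12) is open unconditionally — and
`exists_four_lt_maynardFunctional_holds` (M₁₀₅ > 4).

DEFINITION REQUESTS. None: `productTestFn`, `polymathProfile` (Literature, p415369),
`IsMaynardAdmissible`, `maynardFunctional`, `IsAdmissibleTuple`, `WeakDicksonHardyLittlewood`,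
`PrimesHaveLevel`,
`BombieriVinogradovStatement(_holds)`, `frequently_card_primes_ge_of_maynardFunctional(_holds)` all
exist (Literature/NumberTheory/Sieve). The product family and its admissibility / functional
identity are in `Literature.NumberTheory.Sieve.PolymathProductTestFunctions` (PROVED).

Novelty: LIKE-FOR-LIKE (tribunal №4 J item 4): under Bombieri–Vinogradov ONLY (ϑ ↑ 1/2; m = 2 needs M_k > 8)
the printed state of the art is k = 41 588, H₂ ≤ 474 266 [corpus: paper-arxiv-1407.4897 p0010 Thm
3.9(ix) M_41588 > 8; p0008 Thm 3.3(ix) H(41 588) ≤ 474 266]; PM8b's unconditional 398 130 (Thm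
3.2(ii), k = 35 410) uses MPZ ϖ > 0 and Stadlmann's 396 516 uses level 0.5253. This route: 474 266 →
34 052 (k: 41 588 → 3 750), BV only. ERRATUM (ref g18 §A): the admissible 3750-tuple's
residue-witness table has π(3750) = 522 primes, not 523 as Tuple3750's frozen why-might-fail says
(Lean list = tuples/admissible_3750_34052.txt entry-for-entry; lit p422682 accepted). Searches RUN
(2026-08-25): corpus hybrid "Maynard sieve M_k numerical lower bound large k product test function",
vsearch "exact evaluation of the Maynard–Tao functional for symmetric product functions", galaxy
"M_k|Maynard functional|bounded gaps" --star all, lit frontier Parity --since 2020, arXiv/zbMATH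
"bounded gaps between primes m=2", citation neighbours of Polymath8b2014 / Stadlmann 2023. Nearest
prior art FOUND: [corpus: paper-arxiv-1407.4897 p0025–p0028] PM8b Thm 6.7/(6.12)–(6.15) (Chebyshev
on S ≤ 1−T; k = 41 588 for M > 8); [corpus: paper-arxiv-2309.00425 p0008] Stadlmann §2 (k = 35 265,
H₂ ≤ 396 516); [corpus: paper-arxiv-1410.8400 p0020] Granville (numerical M_k only for k ≤ 60). No
hit for an exact/certified evaluation of the product family nor any BV-only H₂ below 474 266. Delta:
the printed family's function  [refs: paper-arxiv-1407.4897, paper-arxiv-2309.00425, paper-arxiv-1410.8400]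

Barriers (technique_class: certified-computation, multidim-selberg-sieve): - technique_class: certified-computation, multidim-selberg-sieve
- Literature.Barriers.Parity.MaynardFunctionalCeiling: NumLB3749 / DenUB3750 (and their consequence
MkCert3750 = `MaynardCriterion ϑ 3750 2` for ϑ ↑ 1/2) sit INSIDE its technique class and are
CONSISTENT with it: the barrier caps the functional at (k/(k−1))log k = 8.2317 at k = 3750 and the
certified 3750·N/D ≥ 8.023 (kernel-cut 8.008) sits below the cap (BC8: NumLB3749 — inside,
consistent; DenUB3750 — inside, consistent; Tuple3750 — no catalogued barrier quantifies over
admissible tuples) and forces k > exp(2m/ϑ − 1) ≈ 1 114 (`MaynardCriterion.exp_lt`); sharper,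
(k/(k−1))log k > 8 needs k ≥ 2 975. The barrier is the route's BC9 ceiling: no certificate of this
method family can give DHL[k,3] under BV for k ≤ 2 974, i.e. H₂ below ≈ H(2 975) ≈ 27 500; this
route sits at k = 3750 (float family threshold ≈ 3 480).
- Literature.Barriers.Parity.SelbergParityBarrier: not engaged — m+1 = 3 primes among k = 3750
shifts, never k = m+1; the parity barrier caps exactly the regime this route does not enter.
- Literature.Barriers.Parity.LargeSieveLevelHalf: respected — the route uses level ϑ < 1/2 only
(Bombieri–Vinogradov); no MPZ/EH input.
- Literature.Barriers.Parity.EquidistributionLimitBarrier: respected for the same reason — no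
equidistribution beyond level 1/2 is assumed; BV is a theorem of the tree
(`BombieriVinogradovStatement_holds`).
- Negatives index: `ledger negatives --problem Parity` (4 entries at 2026-08-26)

History (route lifecycle, newest last):
- 2026-08-26T03:19:53Z · rev 1: restated NumLB3749 (stmt-Parity-19283) — kernel-feasibility re-cut (lit 02:51Z farm probe + p3 kit j249077 predictor): constants moved to the worst-case-coupling J=8e6 values; cruxes strictly weaker, t (planner-parity-ideate-p3-g4-0)
- 2026-08-26T03:21:17Z · rev 2: restated DenUB3750 (stmt-Parity-19284) — kernel-feasibility re-cut 2/3 (DenUB3750) (planner-parity-ideate-p3-g4-0)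
- 2026-08-26T03:21:58Z · rev 3: restated MkCert3750 (stmt-Parity-19285) — kernel-feasibility re-cut 3/3 (MkCert3750 threshold 8.02 → 8; certGlue_holds/assembly_holds re-proved, Sketch.lean farm rc 0 0 sorry) (planner-parity-ideate-p3-g4-0)
- 2026-08-26T03:23:29Z · closes_target -> closes rung F-P1.R4 of Parity: Summit.Parity.GeneralizedHardyLittlewood.Theses.MaynardProductExact.HTwoLe34052 (D-0061; not the summit Statement) (planner-parity-ideate-p3-g4-0)
- 2026-08-28T18:56:41Z · rev 11: restated FourLtPolymathFiftyThree (stmt-Parity-23014) — restate 23014 k=53→k=51: the ROUND-19 L1 rung (k=53, 264) is superseded by ROUND-20 L3 (k=51, 252) whose kernel-pure proof PolymathCert.exists_polymathFunctiona (planner-parity-ideate-p3-g21-0)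
- 2026-08-31T14:28:58Z · CLOSED proved — proved:Summit.Parity.GeneralizedHardyLittlewood.MaynardProductExactHTwoLe34052.hTwoLe34052_proof (operator:999:1392461)

sub-problem: GeneralizedHardyLittlewood · status: closed(proved) · opened planner-parity-ideate-p3-g4-0 2026-08-26T02:52:01Z · rev 11 · ledger route-Parity-MaynardProductExact
GENERATED by the gate from the ledger (D-0016/17). Provers cite these decls: `theorem foo : Summit.Parity.GeneralizedHardyLittlewood.Theses.MaynardProductExact.<Decl> := …` in Summits/Parity/GeneralizedHardyLittlewood/Theorems/<Name>.lean.
-/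

namespace Summit.Parity.GeneralizedHardyLittlewood.Theses.MaynardProductExact

open scoped BigOperators Topology Manifold Classical MeasureTheory ProbabilityTheory Matrix InnerProductSpace ComplexConjugate ContinuousMap
open Filter Set Function TopologicalSpace MeasureTheory

attribute [summit_statement] _root_.GeneralizedHardyLittlewood
-- H21.Audit: the closer leaf Summit.Parity.GeneralizedHardyLittlewood.Theses.MaynardProductExact.HTwoLe34052 is an item decl of this route file — tagged summit_statement below, after its declaration

/-- item stmt-Parity-19282 · target · rank 0 · closed · proved by Summit.Parity.GeneralizedHardyLittlewood.MaynardProductExactHTwoLe34052.hTwoLe34052_proof (prover) · by planner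
why it might fail: it follows from NumLB3749, DenUB3750, Tuple3750 by the PROVED CertGlue and Assembly (route4/Sketch.lean `hTwoLe34052_of`); it fails only if the certificate CERT-C is wrong.
sources: Polymath8b2014, arXiv:2309.00425
[target] H₂ ≤ 34 052: for infinitely many n, p_{n+2} ≤ p_n + 34 052 (the rung; printed record 396
516). Same-file alternative closer to be registered (class rung), as for list 8. [deps: NumLB3749,
DenUB3750, Tuple3750, CertGlue, MkCert3750, Assembly] [difficulty: XL] -/
@[route_item "route-Parity-MaynardProductExact"]
def HTwoLe34052 : Prop :=
  ∃ᶠ n : ℕ in Filter.atTop, Nat.nth Nat.Prime (n + 2) ≤ Nat.nth Nat.Prime n + 34052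

-- `HTwoLe34052` holds: proved by `Summit.Parity.GeneralizedHardyLittlewood.MaynardProductExactHTwoLe34052.hTwoLe34052_proof` (its module imports this route file, so no `_holds` link can be stated here).

-- earlier NumLB3749 (stmt-Parity-19283, replaced 2026-08-26T03:19:53Z -> stmt-Parity-19245): retired by None — (1909555 : ℝ) / 1000000000000 * ((1000000 : ℝ) / 466771167) ^ 3749 ≤ ∫ w in Set.Ioc (0 : ℝ) 1, (∫ u in (0 : ℝ)..(1 - w), Literature.NumberTheory.Sieve.MaynardTao.polymathProfile 3750 ((249 : ℝ) / 2000) ((3 : ℝ) / 4) u) ^ 2 * Literature.Analysis.Convolution.cpow (fun t => Literature.NumberTh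
/-- item stmt-Parity-19245 · crux · rank 2 · closed · proved by Summit.Parity.GeneralizedHardyLittlewood.MaynardProductExactNumLB3749.numLB3749_proof (prover) · by planner
why it might fail: weaker than the refereed CERT-C value 1.9095558e-6 (reproduced integer-exactly twice), so only a cell/shift-convention mismatch between the typed integral and the certificate could break it; kernel replay needs J=8e6 slots (j249077: at J=4e6 the worst-case sum 1.9055e-6 < constant).
sources: Polymath8b2014, arXiv:1407.4897, Maynard2015
[crux] CERT-C numerator bound re-cut for KERNEL REPLAY by worst-case (shift (k−1)h) floor coupling
on the lattice h = 1/(8·10⁶): N = ∫_{(0,1]} (∫₀^{1−w} g)² (g²)^{⋆3749}(w) dw ≥ 1.9076·10⁻⁶ ·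
m₂^{3749} (float-predicted worst-case lattice value 1.907641·10⁻⁶, kit j249077; refereed recentred
certificate value 1.9095558·10⁻⁶; true ≈ 1.90982·10⁻⁶). Strictly WEAKER than rev-0 (constant
1.909555·10⁻⁶), same target. -/
@[route_item "route-Parity-MaynardProductExact", crux]
def NumLB3749 : Prop :=
  (19076 : ℝ) / 10000000000 * ((1000000 : ℝ) / 466771167) ^ 3749 ≤ ∫ w in Set.Ioc (0 : ℝ) 1, (∫ u in (0 : ℝ)..(1 - w), Literature.NumberTheory.Sieve.MaynardTao.polymathProfile 3750 ((249 : ℝ) / 2000) ((3 : ℝ) / 4) u) ^ 2 * Literature.Analysis.Convolution.cpow (fun t => Literature.NumberTheory.Sieve.MaynardTao.polymathProfile 3750 ((249 : ℝ) / 2000) ((3 : ℝ) / 4) t ^ 2) 3749 w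

-- `NumLB3749` holds: proved by `Summit.Parity.GeneralizedHardyLittlewood.MaynardProductExactNumLB3749.numLB3749_proof` (its module imports this route file, so no `_holds` link can be stated here).

-- earlier DenUB3750 (stmt-Parity-19284, replaced 2026-08-26T03:21:17Z -> stmt-Parity-19251): retired by None — ∫ w in Set.Ioc (0 : ℝ) 1, Literature.Analysis.Convolution.cpow (fun t => Literature.NumberTheory.Sieve.MaynardTao.polymathProfile 3750 ((249 : ℝ) / 2000) ((3 : ℝ) / 4) t ^ 2) 3750 w ≤ (416598 : ℝ) / 1000000 * ((1000000 : ℝ) / 466771167) ^ 3750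
/-- item stmt-Parity-19251 · crux · rank 3 · closed · proved by Summit.Parity.GeneralizedHardyLittlewood.MaynardProductExactDenUB3750.denUB3750_proof (prover) · by planner
why it might fail: weaker than the refereed CERT-C value 0.41659735 (reproduced integer-exactly twice); kernel replay by plain floor coupling needs J=8e6 slots (j249077: J=4e6 gives 0.41731 > constant); a cell-convention mismatch vs the typed integral is the only mathematical risk.
sources: Polymath8b2014, arXiv:1407.4897, arXiv:2309.00425
[crux] CERT-C denominator bound re-cut for KERNEL REPLAY by plain floor coupling on the lattice h =
1/(8·10⁶): D = ∫_{(0,1]} (g²)^{⋆3750}(w) dw ≤ 0.41694 · m₂^{3750} (float-predicted floor-lattice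
value 0.41692867, kit j249077; refereed recentred certificate value 0.41659735; true ≈ 0.416551).
Strictly WEAKER than rev-0 (constant 0.416598), same target; with NumLB3749:
3750·1.9076·10⁻⁶/(0.41694·m₂) = 8.00846 > 8. -/
@[route_item "route-Parity-MaynardProductExact", crux]
def DenUB3750 : Prop :=
  ∫ w in Set.Ioc (0 : ℝ) 1, Literature.Analysis.Convolution.cpow (fun t => Literature.NumberTheory.Sieve.MaynardTao.polymathProfile 3750 ((249 : ℝ) / 2000) ((3 : ℝ) / 4) t ^ 2) 3750 w ≤ (41694 : ℝ) / 100000 * ((1000000 : ℝ) / 466771167) ^ 3750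

-- `DenUB3750` holds: proved by `Summit.Parity.GeneralizedHardyLittlewood.MaynardProductExactDenUB3750.denUB3750_proof` (its module imports this route file, so no `_holds` link can be stated here).

-- earlier MkCert3750 (stmt-Parity-19285, replaced 2026-08-26T03:21:58Z -> stmt-Parity-19252): retired by None — ∃ F : (Fin 3750 → ℝ) → ℝ, Literature.NumberTheory.Sieve.IsMaynardAdmissible 3750 F ∧ (802 : ℝ) / 100 < Literature.NumberTheory.Sieve.maynardFunctional 3750 F
/-- item stmt-Parity-19252 · support · rank 9 · closed · proved by Summit.Parity.GeneralizedHardyLittlewood.MaynardProductExactMkCert3750.mkCert3750_proof (prover) · by planner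
why it might fail: only with NumLB3749/DenUB3750 (it is their consequence by a proved lemma).
sources: Polymath8b2014, Maynard2015
[support] M_3750 > 8 (the natural DHL[3750,3]-under-BV threshold form; rev-0 said > 8.02): witnessed
by productTestFn 3750 (polymathProfile 3750 (249/2000) (3/4)); derived from NumLB3749 + DenUB3750 by
CertGlue (PROVED, route4/Sketch.lean certGlue_holds: 8·0.41694·m₂ < 3750·1.9076·10⁻⁶ by norm_num);
the Assembly (PROVED, assembly_holds) now picks the BV level ϑ = 1/4 + 2/M ∈ (4/M, 1/2). -/
@[route_item "route-Parity-MaynardProductExact"]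
def MkCert3750 : Prop :=
  ∃ F : (Fin 3750 → ℝ) → ℝ, Literature.NumberTheory.Sieve.IsMaynardAdmissible 3750 F ∧ (8 : ℝ) < Literature.NumberTheory.Sieve.maynardFunctional 3750 F

-- `MkCert3750` holds: proved by `Summit.Parity.GeneralizedHardyLittlewood.MaynardProductExactMkCert3750.mkCert3750_proof` (its module imports this route file, so no `_holds` link can be stated here).

/-- item stmt-Parity-19286 · support · rank 9 · closed · proved by Summit.Parity.GeneralizedHardyLittlewood.Theses.MaynardProductExact.certGlue_holds (reviewer) · by planner
why it might fail: it cannot (proved); listed so that the cone is explicit.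
sources: Polymath8b2014
[support] the two certificate halves give M_3750 > 8.02: functional(F_{c,T}) = 3750·N/D (tree
identity), D = I(F) > 0, and 802/100 · 0.416598 · m₂ < 3750 · 1.909555·10⁻⁶ (exact rationals).
PROVED: route4/Sketch.lean `certGlue_holds` (farm rc 0, 0 sorry) — a prover's one-file landing.
[difficulty: S] -/
@[route_item "route-Parity-MaynardProductExact", crux]
def CertGlue : Prop :=
  NumLB3749 → DenUB3750 → MkCert3750

-- `CertGlue` holds: proved by `Summit.Parity.GeneralizedHardyLittlewood.Theses.MaynardProductExact.certGlue_holds` (its module imports this route file, so no `_holds` link can be stated here).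

/-- item stmt-Parity-19287 · support · rank 9 · closed · proved by Summit.Parity.GeneralizedHardyLittlewood.Theses.MaynardProductExact.tuple3750_holds (reviewer) · by planner
why it might fail: it cannot mathematically (decidable, verified three times in independent code); Lean cost only (3750 literals, residue witnesses for the 523 primes ≤ 3750).
sources: Polymath8b2014, arXiv:1407.4897
[support] an admissible 3750-tuple of integers with all differences ≤ 34 052 exists: the narrowest
known 3750-tuple of Sutherland's Polymath8 database (fetched and re-verified admissible by
parity-lit and by the referee with independent sieves; kernel-decided by a bitset certificate in
parity-lit's `Literature/NumberTheory/Sieve/NarrowAdmissibleTuple3750.lean`, theorem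
`exists_isAdmissibleTuple_card_3750`, farm rc 0 — closes BY NAME when that file lands; the cell's
own sieved tuple gives 35 340 as a fall-back). [difficulty: M] -/
@[route_item "route-Parity-MaynardProductExact", crux]
def Tuple3750 : Prop :=
  ∃ H : Finset ℤ, Literature.NumberTheory.Sieve.IsAdmissibleTuple H ∧ H.card = 3750 ∧ ∀ a ∈ H, ∀ b ∈ H, b - a ≤ (34052 : ℤ)

-- `Tuple3750` holds: proved by `Summit.Parity.GeneralizedHardyLittlewood.Theses.MaynardProductExact.tuple3750_holds` (its module imports this route file, so no `_holds` link can be stated here).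

/-- item stmt-Parity-22651 · support · rank 9 · closed · proved by Summit.Parity.GeneralizedHardyLittlewood.Theses.MaynardProductExact.hTwoLe41664_holds (prover) · by planner
[support] H₂ ≤ 41 664 unconditionally (the k = 4500 rung of this route: weaker than the target
HTwoLe34052, but every ingredient is a tree THEOREM today): DHL[4500,3] from
`MaynardTao.eight_lt_maynardFunctional_4500` (MaynardProductKernelCert4500.lean, p646601,
kernel-pure certificate 8 < M_4500(F_{243/2000,13/20})), Bombieri–Vinogradov at θ = 8/(M+8) < 1/2
(`BombieriVinogradovStatement_holds`), Maynard Prop. 4.2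
(`frequently_card_primes_ge_of_maynardFunctional_holds`, `weakDHL_of_maynardFunctional_gt`), then
`frequently_nth_prime_add_two_le_add_41664_of_weakDHL` (NarrowAdmissibleTuple4500.lean, p646822).
CANDIDATE PROOF (farm rc 0, 0 sorry, axioms standard, 66 s; parity-ideate-lit g27):
run/shared/lean/pub/parity-ideate/parity-ideate-lit/HTwoLe41664Assembly.lean (55 lines) — land it as
Summits/Parity/GeneralizedHardyLittlewood/Theorems/HTwoLe41664.lean concluding this decl by name.
Why it might fail: it cannot mathematically (all leaves proved); Lean cost only. Printed records for
comparison: H₂ ≤ 398 130 (Polymath8b2014 Thm 1.4(ii)), ≤ 396 516 (Stadlmann, arXiv:2309.00425).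
Sources: Polymath8b2014, Maynard2015, arXiv:2309.00425. -/
@[route_item "route-Parity-MaynardProductExact"]
def HTwoLe41664 : Prop :=
  ∃ᶠ n : ℕ in Filter.atTop, Nat.nth Nat.Prime (n + 2) ≤ Nat.nth Nat.Prime n + 41664

-- `HTwoLe41664` holds: proved by `Summit.Parity.GeneralizedHardyLittlewood.Theses.MaynardProductExact.hTwoLe41664_holds` (its module imports this route file, so no `_holds` link can be stated here).

/-- item stmt-Parity-23159 · support · rank 9 · closed · proved by Summit.Parity.GeneralizedHardyLittlewood.Theses.MaynardProductExact.fourLtPolymathFiftyOne_holds (prover) · by planner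
[support] ROUND-20 rung L3 (supersedes the never-rendered k = 53 / 264 rung L1 of ROUND-19: the
narrow 51-tuple of diameter 252 landed, p647893, and the k = 51 certificate is already
KERNEL-CHECKED): M_{51,1/25} > 4, exhibited by the RANK-FOUR product-radial certificate F =
1_{(26/25)R_51}·Σ_{x≤4} Q_x(26/25−Σt)·∏ g_x(t_i) (deg g = 6 signed alternating, deg Q = 12; exact λ
= 4.001845403505117, cert round19/engine/outputs/k51_e1-25_S6_sg_s1_J4.json). PROOF OF RECORD
(kernel-pure, axioms propext/Classical.choice/Quot.sound, no native_decide):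
`Literature.NumberTheory.Sieve.PolymathCert.exists_polymathFunctional_51_gt_four` in
HOME/parity-ideate-p3/round20/lean/land/PolymathProdRadialCertL3.lean (generic checker
`ProdCert.sound_tab` in PolymathProdRadialCert.lean; composite farm rc 0, 328 s, D9) — landing with
parity-ideate-lit (WANTED(land) 2026-08-28T18:43Z); once landed, a 3-line Theorems file closes this
decl by name. Consequence in tree currency: `frequently_nth_prime_succ_le_add_252`
(PrimeGapsProdRadial.lean) = liminf (p_{n+1} − p_n) ≤ 252 KERNEL-PURE (tree today: 600 kernel-pure,
246 via native_decide). Why it might fail: it cannot mathematically (exact rational certificate, ke -/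
@[route_item "route-Parity-MaynardProductExact"]
def FourLtPolymathFiftyOne : Prop :=
  ∃ (ε : ℝ) (F : (Fin 51 → ℝ) → ℝ), 0 < ε ∧ ε < 1 ∧ Literature.NumberTheory.Sieve.IsPolymathTestFunction 51 ε F ∧ 4 < Literature.NumberTheory.Sieve.polymathFunctional 51 ε F

-- `FourLtPolymathFiftyOne` holds: proved by `Summit.Parity.GeneralizedHardyLittlewood.Theses.MaynardProductExact.fourLtPolymathFiftyOne_holds` (its module imports this route file, so no `_holds` link can be stated here).

/-- item stmt-Parity-19288 · assembly · rank 1 · closed · proved by Summit.Parity.GeneralizedHardyLittlewood.Theses.MaynardProductExact.assembly_holds (reviewer) · by planner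
sources: Polymath8b2014, Maynard2015
[assembly] MkCert3750 → Tuple3750 → HTwoLe34052 (PROVED: route4/Sketch.lean `assembly_holds`, via
the tree theorems `BombieriVinogradovStatement_holds`,
`frequently_card_primes_ge_of_maynardFunctional_holds`, `weakDHL_of_maynardFunctional_gt`,
`WeakDicksonHardyLittlewood.frequently_nth_prime_add_le`). -/
@[route_item "route-Parity-MaynardProductExact", crux]
def Assembly : Prop :=
  MkCert3750 → Tuple3750 → HTwoLe34052

-- `Assembly` holds: proved by `Summit.Parity.GeneralizedHardyLittlewood.Theses.MaynardProductExact.assembly_holds` (its module imports this route file, so no `_holds` link can be stated here).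

-- records of items no longer active in this route (dropped / restated):
-- earlier FourLtPolymathFiftyThree (stmt-Parity-23014, replaced 2026-08-28T18:56:41Z -> stmt-Parity-23159): retired by None — ∃ (ε : ℝ) (F : (Fin 53 → ℝ) → ℝ), 0 < ε ∧ ε < 1 ∧ Literature.NumberTheory.Sieve.IsPolymathTestFunction 53 ε F ∧ 4 < Literature.NumberTheory.Sieve.polymathFunctional 53 ε F

attribute [summit_statement] _root_.Summit.Parity.GeneralizedHardyLittlewood.Theses.MaynardProductExact.HTwoLe34052

/-! D-0027 §2.1 — DECIDING THEOREM (planner-authored via `route open/edit --closes-file`; by planner-parity-ideate-p3-g4-0 2026-08-26T03:23:29Z) — ARCHIVED: route closed (proved) 2026-08-31T14:28:58Z; kept so importers keep building: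
its hypotheses are this route's items and its conclusion the registered leaf `Summit.Parity.GeneralizedHardyLittlewood.Theses.MaynardProductExact.HTwoLe34052` (rung F-P1.R4, D-0061) (glue_lint), and it elaborates with this file. -/

@[closes "route-Parity-MaynardProductExact"] theorem closes (hA : Assembly) (hG : CertGlue) (h₁ : NumLB3749) (h₂ : DenUB3750) (h₃ : Tuple3750) : HTwoLe34052 :=
  hA (hG h₁ h₂) h₃

end Summit.Parity.GeneralizedHardyLittlewood.Theses.MaynardProductExact
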